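import Summits.MatrixMultiplication.MatrixMultiplication.Theses.MarginalColumns
import Summits.MatrixMultiplication.MatrixMultiplication.Theorems.SecondColumnDominates.Negative.FloorOfDominates

/-!
# `AmortisationOfCruxes` (route `MarginalColumns`, support item stmt-MatrixMultiplication-16314)

`SecondColumnDominates → SecondColumnCheap → UniformAmortisation`: with D the tower bound
`T n (v+1) + v·n² ≤ n² + v·T n 2` (`SecondColumnDominates.tower_of_dominates`, landed in
`Theorems/SecondColumnDominates/Negative/FloorOfDominates.lean`) and with C
(`T n 2 ≤ n² + C·n^{1+ε}`) every column `w = v + 1 ≤ n` (indeed every `w ≥ 1`) costs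
`T n w ≤ n² + v·C·n^{1+ε} ≤ n² + max(C,0)·w·n^{1+ε}`. Real-number bookkeeping only.

Landed by the line lead of crux stmt-MatrixMultiplication-16310 (line `Sketch`).
-/

set_option linter.dupNamespace false

noncomputable section

namespace Summit.MatrixMultiplication.MatrixMultiplication.Theorems

open Literature.Computability.AlgebraicComplexity
open Summit.MatrixMultiplication.MatrixMultiplication.Theses.MarginalColumns

/-- **D and C give uniform amortisation of the first `n` columns**: for every `ε > 0` there is
`C'` (namely `max C 0` for the `C` of `SecondColumnCheap` at `ε`) with
`R̲⟨n,n,w⟩ ≤ n² + C'·w·n^{1+ε}` for all `1 ≤ w ≤ n`. [folklore] -/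
theorem amortisationOfCruxes_proof : AmortisationOfCruxes := by
  unfold AmortisationOfCruxes SecondColumnCheap UniformAmortisation
  intro hD hC ε hε
  obtain ⟨C, hCn⟩ := hC ε hε
  refine ⟨max C 0, fun n w hn hw _hwn => ?_⟩
  obtain ⟨v, rfl⟩ : ∃ v, w = v + 1 := ⟨w - 1, by omega⟩
  have ht := SecondColumnDominates.tower_of_dominates hD n hn v
  have h2 := hCn n hn
  have hn0 : (0 : ℝ) < n := by exact_mod_cast (by omega : 0 < n)
  have hpow : 0 ≤ (n : ℝ) ^ (1 + ε) := Real.rpow_nonneg hn0.le _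
  have hC' : C ≤ max C 0 := le_max_left _ _
  have hC0 : 0 ≤ max C 0 := le_max_right _ _
  -- cast the tower bound to ℝ
  have ht' : ((algBorderRank (matMulTensor ℂ n n (v + 1)) : ℕ) : ℝ) + (v : ℝ) * ((n : ℝ) * n) ≤
      (n : ℝ) * n + (v : ℝ) * ((algBorderRank (matMulTensor ℂ n n 2) : ℕ) : ℝ) := by
    exact_mod_cast ht
  have hv0 : (0 : ℝ) ≤ v := by exact_mod_cast Nat.zero_le v
  -- `v · (T 2 − n²) ≤ v · C · n^{1+ε} ≤ max C 0 · (v+1) · n^{1+ε}`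
  have hstep : (v : ℝ) * ((algBorderRank (matMulTensor ℂ n n 2) : ℕ) : ℝ) ≤
      (v : ℝ) * ((n : ℝ) ^ 2 + max C 0 * (n : ℝ) ^ (1 + ε)) := by
    apply mul_le_mul_of_nonneg_left _ hv0
    calc ((algBorderRank (matMulTensor ℂ n n 2) : ℕ) : ℝ) ≤ (n : ℝ) ^ 2 + C * (n : ℝ) ^ (1 + ε) := h2
      _ ≤ (n : ℝ) ^ 2 + max C 0 * (n : ℝ) ^ (1 + ε) := by
          have := mul_le_mul_of_nonneg_right hC' hpow
          linarith
  have hmono : max C 0 * (v : ℝ) * (n : ℝ) ^ (1 + ε) ≤ max C 0 * ((v + 1 : ℕ) : ℝ) * (n : ℝ) ^ (1 + ε) := by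
    apply mul_le_mul_of_nonneg_right _ hpow
    apply mul_le_mul_of_nonneg_left _ hC0
    push_cast
    linarith
  have hsq : (n : ℝ) ^ 2 = (n : ℝ) * n := sq (n : ℝ)
  nlinarith [ht', hstep, hmono, hsq]

end Summit.MatrixMultiplication.MatrixMultiplication.Theorems

end
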